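import Literature.NumberTheory.EllipticCurves.HeegnerPointsKolyvaginPrimaryNoTorsionProofs
import HarnessLib

/-!
# No `p`-torsion over a field of "unramified dihedral type" from IRREDUCIBILITY of `E[p]`
# (Gross 1991, Lemma 4.3 without surjectivity) — ENGINE and TRANSPORT

Cell `b2b-bsdres`, team x11b3 (N8/O2), `h44` programme, offer (P4-C) of x11b3-p4 GEN 6, FILE 1.
Summit-side THEOREM-ONLY file (no definition, no named fact, no `sorry`); p-free (`p` any prime —
the engine does not even use that `p` is odd; oddness enters only through the DATUM `τ` below,
which a consumer produces from the mod-`p` cyclotomic character on inertia at `p`).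

HONEST FRAMING (binding): **plumbing toward the binder `hA` (admissibility of `E(K[m]) ⊂ E(K̄)`
modulo `p^M`, i.e. `E(K[m])[p^M] = 0`, Gross 1991 Lemma 4.3 / McCallum §4 (5)) on the
IRREDUCIBLE-NON-SURJECTIVE cell** (`ClassRecordAtThree`: `¬ Surj W 3 ∧ 3 ∣ v₃(Δ) ∧ ¬ Ram W 3`), where
the tree's two no-torsion theorems do not reach: `torsionBy_eq_bot_of_normal_of_hasSurjectiveModNGaloisRep`
(Gross's printed proof: needs `ρ̄_{E,p}` ONTO) and `torsionBy_eq_bot_of_hasIrreducibleModPGaloisRep`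
(quadratic fields only).  This file proves `E(L)[p] = 0` from `(irr)` for any number field `L`
carrying the following GROUP DATA in `Γ_ℚ` — all HYPOTHESES here, to be instantiated at
`L = K[m]` (ring class field of an imaginary quadratic `K`, `p` unramified in `K`, `p ∤ m`) by a
sequel that identifies them (class field theory of `K[m]`, inertia at `p`; NOT done here):
`A` (printed `Γ_K`, index `2`: `Γ_ℚ = A ∪ cA`, `A` normal, `c² ∈ A`), `N ≤ Γ_ℚ` inside the image of
`Γ_L` and normalised by `A` (printed `Γ_{K[m]} ⊴ Γ_K`: `K[m]/K` Galois), and ONE element `τ` with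
`τ ∈ N`, `c⁻¹τc ∈ N` acting NON-trivially on `E[p]` (printed: an inertia element at a prime above
`p` with non-trivial mod-`p` cyclotomic character — it fixes `K[m]` and `c⁻¹`-conjugate-fixes it
because `K[m]/ℚ` is unramified above `p`, and acts non-trivially on `E[p]` by the Weil pairing).
Nothing is discharged on the residual map by this file alone; `h44` / (γ) / `h37` untouched; nothing
booked; no mark / label / count moves.

THE ARGUMENT (elementary).  Presearch (x11b3-p4 GEN 6, corpus hybrid + vector + galaxy, both
corpora): the nearest printed statement is Gross 1991, Lemma 4.3 itself — under SURJECTIVITY of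
`ρ̄_{E,p}` [corpus: book:editornd-l-functions-arithmetic PDF p. 219], quoted as such by the one
galaxy hit [galaxy: pdf Grossi (ALGANT thesis) p. 94 L13 "lemma 4.3 of [Gro91] … our assumptions on
p force E_p(K_n) to be trivial"]; no irreducible-only statement was found (queries: "no p-torsion
over ring class field residual representation irreducible", "E[p] irreducible implies E(K[n])[p] = 0
ring class field", galaxy needles "no p-torsion over K_n|torsion rational over K_n|E_p(K_n) = 0",
"E(K_c)[p] = 0|E(K[n])[p]|E[p](K_n)").  Let `U = E[p]^N`.  `U` is `A`-stable (`N` normalised by `A`), so is `cU`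
(`A` normal), and `Γ_ℚ = A ∪ cA` with `c² ∈ A` permutes `{U, cU}`; hence `U + cU` is
`Γ_ℚ`-stable, and non-zero as soon as `E(L)[p] ≠ 0`; by `(irr)` it is all of `E[p]`.  But `τ`
fixes `U` pointwise (`τ ∈ N`) and fixes `cU` pointwise (`τ·cu = c·(c⁻¹τc)u = cu`), so `τ` acts
trivially on `E[p]` — contradiction.

## What is proved

* `NoTorsionIrr.smul_eq_self_of_irreducible_of_biFixed` — the ENGINE (abstract `Γ ↷ M`): under
  `(irr)` and the group data, a non-zero `N`-fixed vector forces `τ` to act trivially on `M`.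
* `NoTorsionIrr.torsionBy_eq_bot_of_hasIrreducibleModPGaloisRep_of_biFixed_type` — **`E(L)[p] = 0`**
  for `L : Type` from `W.HasIrreducibleModPGaloisRep p` and the group data (transport
  `E(L) → E(L̄) ← E(ℚ̄)` exactly as in the tree's `torsionBy_eq_bot_of_normal_of_hasSurjectiveModNGaloisRep_type`).
* `NoTorsionIrr.torsionBy_eq_bot_of_hasIrreducibleModPGaloisRep_of_biFixed` — the same for
  `L : Type u` (via a `Type` model `L₀ ≃ₐ[ℚ] L`).
* `NoTorsionIrr.torsionBy_pow_eq_bot_of_hasIrreducibleModPGaloisRep_of_biFixed` — **`E(L)[p^M] = 0`**.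

## References

* [GrossLMS1991] B. H. Gross, *Kolyvagin's work on modular elliptic curves*, LMS LNS 153 (1991),
  §4, Lemma 4.3 (held `book:editornd-l-functions-arithmetic`, PDF p. 219) — the surjective case.
* [McCallumLMS1991] W. G. McCallum, *Kolyvagin's work on Shafarevich–Tate groups*, same volume,
  §4 (5).
* [Serre1972] J.-P. Serre, *Propriétés galoisiennes des points d'ordre fini des courbes
  elliptiques*, Invent. Math. 15 (1972), §1.7–§1.8 (cyclotomic character on inertia).

## Mathlib / tree search

Tree: `HeegnerPointsKolyvaginPrimaryNoTorsionProofs` (`torsionBy_pow_eq_bot`, the surjective twin),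
`HeegnerPointsKolyvaginTorsionProofs` (`pointsMapOfEmb_bijective`, `pointsMap_smul`, `closureEmb`,
`exists_algEquiv_numberField_type`, `torsionBy_eq_bot_of_algEquiv`), `GaloisAction`
(`HasIrreducibleModPGaloisRep`, `geomTorsion`).  Mathlib: `AddSubgroup.map`, `AddSubgroup.mem_sup`,
`DistribSMul.toAddMonoidHom`.  `lean search 'NoTorsionIrr|of_biFixed|NoTorsionOfIrreducible'`
→ no matches (INTENT-grep).
-/

noncomputable section

open scoped Classical

universe u

namespace Summit.BirchSwinnertonDyer.Rank1Residual.X11b.NoTorsionIrr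

open Literature.NumberTheory.EllipticCurves
open Field (absoluteGaloisGroup)
open Field.absoluteGaloisGroup (toAlgEquiv)

/-! ## §1 The engine -/

section Engine

variable {Γ : Type*} [Group Γ] {M : Type*} [AddCommGroup M] [DistribMulAction Γ M]

/-- **ENGINE.** Let `Γ` act on `M` irreducibly (the only `Γ`-stable subgroups are `⊥`, `⊤`), let
`A ≤ Γ` be a normal subgroup with `Γ = A ∪ cA` and `c² ∈ A`, and `N ≤ Γ` a subgroup normalised by
`A`.  If some `x ≠ 0` is fixed by `N`, then every `τ ∈ N` with `c⁻¹τc ∈ N` acts TRIVIALLY on `M`: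
`U = M^N` and `cU` are `A`-stable, `U + cU ∋ x` is `Γ`-stable hence everything, and `τ` fixes `U`
and `cU` pointwise. [folklore] -/
theorem smul_eq_self_of_irreducible_of_biFixed
    (hirr : ∀ H : AddSubgroup M, (∀ g : Γ, ∀ y ∈ H, g • y ∈ H) → H = ⊥ ∨ H = ⊤)
    (A N : Subgroup Γ) (c : Γ) (hA : ∀ g : Γ, g ∈ A ∨ c⁻¹ * g ∈ A)
    (hAn : ∀ g : Γ, ∀ a ∈ A, g * a * g⁻¹ ∈ A) (hc2 : c * c ∈ A)
    (hNA : ∀ a ∈ A, ∀ n ∈ N, a * n * a⁻¹ ∈ N)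
    {τ : Γ} (hτ : τ ∈ N) (hτc : c⁻¹ * τ * c ∈ N) {x : M} (hx : x ≠ 0)
    (hfix : ∀ n ∈ N, n • x = x) : ∀ y : M, τ • y = y := by
  -- `U = M^N`
  let U : AddSubgroup M :=
    { carrier := {y | ∀ n ∈ N, n • y = y}
      zero_mem' := fun n _ ↦ smul_zero n
      add_mem' := by
        intro u v hu hv n hn
        rw [smul_add, hu n hn, hv n hn]
      neg_mem' := by
        intro u hu n hn
        rw [smul_neg, hu n hn] }
  have hU : ∀ y, y ∈ U ↔ ∀ n ∈ N, n • y = y := fun _ ↦ Iff.rfl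
  -- `U` is `A`-stable
  have hUA : ∀ a ∈ A, ∀ y ∈ U, a • y ∈ U := by
    intro a ha y hy n hn
    have h1 : a⁻¹ * n * a ∈ N := by
      have := hNA a⁻¹ (A.inv_mem ha) n hn
      rwa [inv_inv] at this
    calc n • a • y = a • ((a⁻¹ * n * a) • y) := by
          rw [← mul_smul, ← mul_smul]
          congr 1
          group
      _ = a • y := by rw [(hU y).mp hy _ h1]
  -- `cU`
  let f : M →+ M := DistribSMul.toAddMonoidHom M c
  have hf : ∀ y, f y = c • y := fun _ ↦ rfl
  -- `cU` is `A`-stable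
  have hcUA : ∀ a ∈ A, ∀ y ∈ U.map f, a • y ∈ U.map f := by
    intro a ha y hy
    obtain ⟨u, hu, rfl⟩ := AddSubgroup.mem_map.mp hy
    have h1 : c⁻¹ * a * c ∈ A := by
      have := hAn c⁻¹ a ha
      rwa [inv_inv] at this
    refine AddSubgroup.mem_map.mpr ⟨(c⁻¹ * a * c) • u, hUA _ h1 u hu, ?_⟩
    rw [hf, hf, ← mul_smul, ← mul_smul]
    congr 1
    group
  -- outside `A`: `g = c a'` swaps `U` and `cU`
  have hswapU : ∀ g : Γ, c⁻¹ * g ∈ A → ∀ y ∈ U, g • y ∈ U.map f := by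
    intro g hg y hy
    refine AddSubgroup.mem_map.mpr ⟨(c⁻¹ * g) • y, hUA _ hg y hy, ?_⟩
    rw [hf, ← mul_smul]
    congr 1
    group
  have hswapcU : ∀ g : Γ, c⁻¹ * g ∈ A → ∀ y ∈ U.map f, g • y ∈ U := by
    intro g hg y hy
    obtain ⟨u, hu, rfl⟩ := AddSubgroup.mem_map.mp hy
    -- `g c = (c c) (c⁻¹ (c⁻¹ g) c)`
    have h1 : c⁻¹ * (c⁻¹ * g) * c ∈ A := by
      have := hAn c⁻¹ (c⁻¹ * g) hg
      rwa [inv_inv] at this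
    have h2 : g * c = (c * c) * (c⁻¹ * (c⁻¹ * g) * c) := by group
    rw [hf, ← mul_smul, h2, mul_smul]
    exact hUA _ hc2 _ (hUA _ h1 u hu)
  -- `S = U + cU` is `Γ`-stable
  have hS : ∀ g : Γ, ∀ y ∈ U ⊔ U.map f, g • y ∈ U ⊔ U.map f := by
    intro g y hy
    obtain ⟨u, hu, v, hv, rfl⟩ := AddSubgroup.mem_sup.mp hy
    rw [smul_add]
    rcases hA g with hg | hg
    · exact AddSubgroup.add_mem _ (AddSubgroup.mem_sup_left (hUA g hg u hu))
        (AddSubgroup.mem_sup_right (hcUA g hg v hv))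
    · exact AddSubgroup.add_mem _ (AddSubgroup.mem_sup_right (hswapU g hg u hu))
        (AddSubgroup.mem_sup_left (hswapcU g hg v hv))
  -- `x ∈ U`, so `S ≠ ⊥`, hence `S = ⊤`
  have hxU : x ∈ U := hfix
  have hStop : U ⊔ U.map f = ⊤ := by
    refine (hirr _ hS).resolve_left fun hbot ↦ hx ?_
    have : x ∈ U ⊔ U.map f := AddSubgroup.mem_sup_left hxU
    rw [hbot] at this
    exact (AddSubgroup.mem_bot).mp this
  -- `τ` fixes `U` and `cU` pointwise
  intro y
  have hy : y ∈ U ⊔ U.map f := hStop ▸ AddSubgroup.mem_top y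
  obtain ⟨u, hu, v, hv, rfl⟩ := AddSubgroup.mem_sup.mp hy
  obtain ⟨u', hu', rfl⟩ := AddSubgroup.mem_map.mp hv
  rw [smul_add, (hU u).mp hu τ hτ, hf, ← mul_smul]
  congr 1
  have h1 : τ * c = c * (c⁻¹ * τ * c) := by group
  rw [h1, mul_smul, (hU u').mp hu' _ hτc]

end Engine

/-! ## §2 Transport to `E(L)[p]` -/

section Torsion

variable (L : Type) [Field L] [NumberField L] (W : WeierstrassCurve ℚ)

/-- **`E(L)[p] = 0` from `(irr)` and "unramified dihedral-type" group data** (`L : Type`).  Let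
`W/ℚ` be elliptic with `E[p]` an IRREDUCIBLE `Γ_ℚ`-module, and `L` a number field with subgroups
`A, N ≤ Γ_ℚ` and elements `c, τ ∈ Γ_ℚ` such that: `Γ_ℚ = A ∪ cA`, `A` is normal, `c² ∈ A`
(printed: `A = Γ_K`, `[K : ℚ] = 2`); `N` lies in the image of `Γ_L → Γ_ℚ` and is normalised by `A`
(printed: `N = Γ_{K[m]}`, `K[m]/K` Galois); `τ ∈ N`, `c⁻¹τc ∈ N`, and `τ` moves some point of
`E[p]` (printed: inertia above `p ∤ m·d_K` with non-trivial cyclotomic character).  Then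
`E(L)[p] = 0`: a point `0 ≠ P ∈ E(L)[p]` gives `0 ≠ Q ∈ E[p]` fixed by the image of `Γ_L`, hence by
`N`, and the engine makes `τ` act trivially on `E[p]`.  Gross 1991, Lemma 4.3 is the surjective
case. [cite: GrossLMS1991, Lemma 4.3] [cite: McCallumLMS1991, §4 (5)] -/
theorem torsionBy_eq_bot_of_hasIrreducibleModPGaloisRep_of_biFixed_type {p : ℕ}
    (hirr : W.HasIrreducibleModPGaloisRep p)
    (A N : Subgroup (absoluteGaloisGroup ℚ)) (c : absoluteGaloisGroup ℚ)
    (hA : ∀ g : absoluteGaloisGroup ℚ, g ∈ A ∨ c⁻¹ * g ∈ A)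
    (hAn : ∀ g : absoluteGaloisGroup ℚ, ∀ a ∈ A, g * a * g⁻¹ ∈ A) (hc2 : c * c ∈ A)
    (hNA : ∀ a ∈ A, ∀ n ∈ N, a * n * a⁻¹ ∈ N)
    (hN : ∀ n ∈ N, ∃ t : absoluteGaloisGroup L, resGal (K := ℚ) L t = n)
    {τ : absoluteGaloisGroup ℚ} (hτ : τ ∈ N) (hτc : c⁻¹ * τ * c ∈ N)
    (hτE : ∃ P : WeierstrassCurve.geomTorsion W (p : ℤ), τ • P ≠ P) :
    AddSubgroup.torsionBy (W.baseChange L).toAffine.Point (p : ℤ) = ⊥ := by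
  rw [eq_bot_iff]
  intro P hP
  rw [AddSubgroup.mem_bot]
  by_contra hP0
  have hPp : p • P = 0 := AddSubgroup.torsionBy.nsmul_iff.mp hP
  -- the point over `L̄` and its preimage `Q` over `ℚ̄`
  let f : L →ₐ[ℚ] AlgebraicClosure L := (algebraMap L (AlgebraicClosure L)).toRatAlgHom
  let φ : (W.baseChange L).toAffine.Point →+ localPoints W L :=
    WeierstrassCurve.Affine.Point.map f
  have hφ : Function.Injective φ := WeierstrassCurve.Affine.Point.map_injective _
  obtain ⟨Q, hQ⟩ := (pointsMapOfEmb_bijective L W (closureEmb (K := ℚ) L)).2 (φ P)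
  have hQ' : pointsMap W L Q = φ P := hQ
  have hinj : Function.Injective (pointsMap W L) :=
    (pointsMapOfEmb_bijective L W (closureEmb (K := ℚ) L)).1
  have hQ0 : Q ≠ 0 := by
    rintro rfl
    apply hP0
    apply hφ
    rw [map_zero, ← hQ', map_zero]
  have hQp : p • Q = 0 := by
    apply hinj
    rw [map_nsmul, map_zero, hQ', ← map_nsmul, hPp, map_zero]
  -- `Q` is fixed by `Γ_L`, hence by `N`
  have hfixL : ∀ t : absoluteGaloisGroup L, resGal (K := ℚ) L t • Q = Q := by
    intro t
    apply hinj
    rw [pointsMap_smul, hQ']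
    change WeierstrassCurve.Affine.Point.map
        ((AlgEquiv.restrictScalars ℚ (toAlgEquiv L t) :
            AlgebraicClosure L ≃ₐ[ℚ] AlgebraicClosure L) :
          AlgebraicClosure L →ₐ[ℚ] AlgebraicClosure L)
        (WeierstrassCurve.Affine.Point.map f P) =
      WeierstrassCurve.Affine.Point.map f P
    have hgf : ((AlgEquiv.restrictScalars ℚ (toAlgEquiv L t) :
            AlgebraicClosure L ≃ₐ[ℚ] AlgebraicClosure L) :
          AlgebraicClosure L →ₐ[ℚ] AlgebraicClosure L).comp f = f := by
      ext x
      exact (toAlgEquiv L t).commutes x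
    rw [WeierstrassCurve.Affine.Point.map_map, hgf]
  have hfixN : ∀ n ∈ N, n • Q = Q := fun n hn ↦ by
    obtain ⟨t, rfl⟩ := hN n hn
    exact hfixL t
  -- the engine in `E[p]`
  let Mp := ↥(WeierstrassCurve.geomTorsion W (p : ℤ))
  let Qm : Mp := ⟨Q, AddSubgroup.torsionBy.nsmul_iff.mpr hQp⟩
  have hQm0 : Qm ≠ 0 := fun h ↦ hQ0 (congrArg Subtype.val h)
  have hQmN : ∀ n ∈ N, n • Qm = Qm := fun n hn ↦ Subtype.ext (hfixN n hn)
  have hirr' : ∀ H : AddSubgroup Mp,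
      (∀ g : absoluteGaloisGroup ℚ, ∀ y ∈ H, g • y ∈ H) → H = ⊥ ∨ H = ⊤ := hirr
  have key := smul_eq_self_of_irreducible_of_biFixed hirr' A N c hA hAn hc2 hNA hτ hτc hQm0 hQmN
  obtain ⟨R, hR⟩ := hτE
  exact hR (key R)

end Torsion

/-! ## §3 Universe-polymorphic statements and `p^M` -/

section Universe

/-- **`E(L)[p] = 0` from `(irr)` and the group data**, for `L : Type u` — through a `Type` model
`L₀ ≃ₐ[ℚ] L` of `L` carrying the hypothesis `hN` (as in the tree's surjective twin).
[cite: GrossLMS1991, Lemma 4.3] -/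
theorem torsionBy_eq_bot_of_hasIrreducibleModPGaloisRep_of_biFixed (W : WeierstrassCurve ℚ)
    {L : Type u} [Field L] [NumberField L] {L₀ : Type} [Field L₀] [NumberField L₀]
    (e : L₀ ≃ₐ[ℚ] L) {p : ℕ} (hirr : W.HasIrreducibleModPGaloisRep p)
    (A N : Subgroup (absoluteGaloisGroup ℚ)) (c : absoluteGaloisGroup ℚ)
    (hA : ∀ g : absoluteGaloisGroup ℚ, g ∈ A ∨ c⁻¹ * g ∈ A)
    (hAn : ∀ g : absoluteGaloisGroup ℚ, ∀ a ∈ A, g * a * g⁻¹ ∈ A) (hc2 : c * c ∈ A)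
    (hNA : ∀ a ∈ A, ∀ n ∈ N, a * n * a⁻¹ ∈ N)
    (hN : ∀ n ∈ N, ∃ t : absoluteGaloisGroup L₀, resGal (K := ℚ) L₀ t = n)
    {τ : absoluteGaloisGroup ℚ} (hτ : τ ∈ N) (hτc : c⁻¹ * τ * c ∈ N)
    (hτE : ∃ P : WeierstrassCurve.geomTorsion W (p : ℤ), τ • P ≠ P) :
    AddSubgroup.torsionBy (W.baseChange L).toAffine.Point (p : ℤ) = ⊥ :=
  torsionBy_eq_bot_of_algEquiv W e
    (torsionBy_eq_bot_of_hasIrreducibleModPGaloisRep_of_biFixed_type L₀ W hirr A N c hA hAn hc2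
      hNA hN hτ hτc hτE)

/-- **`E(L)[p^M] = 0`** under the same hypotheses (McCallum 1991, §4 (5): *"`E` has no
`K_n`-rational `p`-torsion"*, the uniqueness of `p^M`-division points in McCallum's cocycle).
[cite: McCallumLMS1991, §4 (5)] [cite: GrossLMS1991, Lemma 4.3] -/
theorem torsionBy_pow_eq_bot_of_hasIrreducibleModPGaloisRep_of_biFixed (W : WeierstrassCurve ℚ)
    {L : Type u} [Field L] [NumberField L] {L₀ : Type} [Field L₀] [NumberField L₀]
    (e : L₀ ≃ₐ[ℚ] L) {p : ℕ} (hirr : W.HasIrreducibleModPGaloisRep p)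
    (A N : Subgroup (absoluteGaloisGroup ℚ)) (c : absoluteGaloisGroup ℚ)
    (hA : ∀ g : absoluteGaloisGroup ℚ, g ∈ A ∨ c⁻¹ * g ∈ A)
    (hAn : ∀ g : absoluteGaloisGroup ℚ, ∀ a ∈ A, g * a * g⁻¹ ∈ A) (hc2 : c * c ∈ A)
    (hNA : ∀ a ∈ A, ∀ n ∈ N, a * n * a⁻¹ ∈ N)
    (hN : ∀ n ∈ N, ∃ t : absoluteGaloisGroup L₀, resGal (K := ℚ) L₀ t = n)
    {τ : absoluteGaloisGroup ℚ} (hτ : τ ∈ N) (hτc : c⁻¹ * τ * c ∈ N)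
    (hτE : ∃ P : WeierstrassCurve.geomTorsion W (p : ℤ), τ • P ≠ P) (M : ℕ) :
    AddSubgroup.torsionBy (W.baseChange L).toAffine.Point ((p ^ M : ℕ) : ℤ) = ⊥ :=
  torsionBy_pow_eq_bot
    (torsionBy_eq_bot_of_hasIrreducibleModPGaloisRep_of_biFixed W e hirr A N c hA hAn hc2 hNA hN
      hτ hτc hτE) M

end Universe

end Summit.BirchSwinnertonDyer.Rank1Residual.X11b.NoTorsionIrr

end
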